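import Summits.MatrixMultiplication.MatrixMultiplication.Theorems.ThinBlockAlphaUSPToBounded
import Literature.Computability.AlgebraicComplexity.GroupTheoreticMatMulProofs
import Literature.Computability.AlgebraicComplexity.LocalStrongUSP
import HarnessLib

/-!
# ω-census, family (b) group-theoretic: the exact ω-bound of a local strong USP instance

HONEST FRAMING (pub-omega census; verbatim): lottery ticket; floor = certified bounds/negative ranges.
This file is census BOOKKEEPING for the group-theoretic family, not progress on `ω`: the tree already proves
`ω < 2.373` by the laser method (`LeGall2014_cw4`); every bound derivable here is `≥ 2.40` (Cohn–Kleinberg–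
Szegedy–Umans 2005, Thm. 37 + Coppersmith–Winograd USP capacity) and, for the finite puzzles actually certified,
`≥ 2.5`.

## Content

For a LOCAL STRONG USP `U` of `s` rows and width `k` (CKSU 2005 §6.1; tree `IsLocalStrongUSP`) and any modulus
`m ≥ 3`, the STPP family `(A_u, B_u, C_u)_{u ∈ U}` in `Cyc_m^k` of CKSU Thm. 33 (tree-PROVED:
`CohnKleinbergSzegedyUmans2005_thm33_holds`) has `|A_u||B_u||C_u| = (m-1)^k` for every row (support counting,
`card_uspA/B/C`), so CKSU Thm. 5.5 (abelian case; tree-PROVED: `CohnKleinbergSzegedyUmans2005_5_5_abelian_holds`)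
reads `s · (m-1)^{kω/3} ≤ m^k`, i.e. the EXACT closed form

  `ω ≤ 3 (k log m − log s) / (k log (m − 1))`            (`omega_le_of_isLocalStrongUSP`),

which is Anderson–Le 2023 (arXiv:2307.06463), Thm. 2, restricted to local SUSPs (where it needs no "simplifiable ⇒
infinite family" step: Thm. 33 + the asymptotic sum inequality give the family-strength bound directly), and CKSU
Cor. 16 with `log |U|!/(|U| k)` replaced by `log |U| / k`.  A decimal consequence `ω ≤ a/b` is decided by ONE integer
inequality `m^{3bk} ≤ s^{3b} (m-1)^{ak}` (`omega_le_div_of_isLocalStrongUSP`), so census rows are kernel-checkable: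
`decide` the puzzle, `decide`/`norm_num` the integer inequality.

These two theorems are the Lean engine (E2) of sub-family (b1) of the ω construction census
(`run/shared/lean/pub/pub-omega/pub-omega-group/`); the python engine E1 evaluates the same closed form by
integer power comparison.  Instances (specific puzzles found by the SAT census) live in sibling files.

References: H. Cohn, R. Kleinberg, B. Szegedy, C. Umans, FOCS 2005 (arXiv:math/0511460) §6.1, Thm. 33, Thm. 31
(= Thm. 5.5 of the tree's numbering); M. Anderson, V. Le, COCOON 2023 (arXiv:2307.06463) Thm. 2, Table 1.
-/

noncomputable section

open Finset
open Literature.Computability.AlgebraicComplexity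
open Summit.MatrixMultiplication.MatrixMultiplication.Theorems (card_uspA card_uspB card_uspC)

namespace Summit.MatrixMultiplication.OmegaCensus

/-- The three symbol classes of a row of width `k` over `Fin 3` partition the `k` columns:
`#{j | u_j = 0} + #{j | u_j = 1} + #{j | u_j = 2} = k`. [folklore] -/
theorem card_filter_symbols_eq {k : ℕ} (u : Fin k → Fin 3) :
    (univ.filter fun j => u j = 0).card + (univ.filter fun j => u j = 1).card +
      (univ.filter fun j => u j = 2).card = k := by
  have h : (univ : Finset (Fin k)).card = ∑ b : Fin 3, (univ.filter fun j => u j = b).card :=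
    Finset.card_eq_sum_card_fiberwise (fun j _ => mem_univ (u j))
  rw [Finset.card_univ, Fintype.card_fin, Fin.sum_univ_three] at h
  exact h.symm

/-- For the CKSU sets of Thm. 33, every row `u` of width `k` has `|A_u| |B_u| |C_u| = (ℓ-1)^k`
(each column contributes a factor `ℓ - 1` to exactly one of the three sets).
[cite: CohnKleinbergSzegedyUmans2005, Thm. 33 (p. 10)] -/
theorem card_usp_triple_mul (ℓ : ℕ) [NeZero ℓ] {k L : ℕ} (row : Fin L → Fin k → Fin 3) (a : Fin L) :
    (uspA ℓ row a).card * (uspB ℓ row a).card * (uspC ℓ row a).card = (ℓ - 1) ^ k := by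
  rw [card_uspA, card_uspB, card_uspC, ← pow_add, ← pow_add, card_filter_symbols_eq]

/-- **The census inequality of a local strong USP.** If `row` is a local strong USP with `s` rows of width
`k`, then for every modulus `m ≥ 1`: `s · ((m-1)^k)^{ω/3} ≤ m^k` (CKSU Thm. 33 + Thm. 5.5 in `Cyc_m^k`, both
tree-proved; support counting). [cite: CohnKleinbergSzegedyUmans2005, Thm. 33 and Thm. 31] -/
theorem mul_rpow_le_pow_of_isLocalStrongUSP {s k : ℕ} {row : Fin s → Fin k → Fin 3}
    (hU : IsLocalStrongUSP row) (m : ℕ) [NeZero m] :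
    (s : ℝ) * ((((m - 1) ^ k : ℕ) : ℝ)) ^ (omega ℂ / 3) ≤ ((m ^ k : ℕ) : ℝ) := by
  classical
  have hST := CohnKleinbergSzegedyUmans2005_thm33_holds m k s row hU
  have h55 := CohnKleinbergSzegedyUmans2005_5_5_abelian_holds (Fin k → ZMod m) s (uspA m row) (uspB m row)
    (uspC m row) hST
  have hcard : (Fintype.card (Fin k → ZMod m) : ℝ) = ((m ^ k : ℕ) : ℝ) := by
    rw [Fintype.card_fun, ZMod.card, Fintype.card_fin]
  rw [hcard] at h55
  have hsum : ∑ i : Fin s, ((((uspA m row i).card * (uspB m row i).card * (uspC m row i).card : ℕ) : ℝ)) ^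
      (omega ℂ / 3) = (s : ℝ) * ((((m - 1) ^ k : ℕ) : ℝ)) ^ (omega ℂ / 3) := by
    simp_rw [card_usp_triple_mul]
    rw [Finset.sum_const, Finset.card_univ, Fintype.card_fin, nsmul_eq_mul]
  rw [hsum] at h55
  exact h55

/-- **Exact ω-bound of a local strong USP instance** (closed form). A local strong USP with `s ≥ 1` rows of width
`k ≥ 1` gives, for every modulus `m ≥ 3`, `ω ≤ 3 (k log m − log s) / (k log (m − 1))`
(Anderson–Le 2023 Thm. 2 for local SUSPs; CKSU 2005 Cor. 16 with the family-strength constant).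
[cite: CohnKleinbergSzegedyUmans2005, Thm. 33 and Thm. 31] -/
theorem omega_le_of_isLocalStrongUSP {s k : ℕ} {row : Fin s → Fin k → Fin 3}
    (hU : IsLocalStrongUSP row) (hs : 0 < s) (hk : 0 < k) {m : ℕ} (hm : 3 ≤ m) :
    omega ℂ ≤ 3 * ((k : ℝ) * Real.log m - Real.log s) / ((k : ℝ) * Real.log ((m : ℝ) - 1)) := by
  haveI : NeZero m := ⟨by omega⟩
  have key := mul_rpow_le_pow_of_isLocalStrongUSP hU m
  have hX1 : (1 : ℝ) < (m : ℝ) - 1 := by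
    have : (3 : ℝ) ≤ (m : ℝ) := by exact_mod_cast hm
    linarith
  have hX0 : (0 : ℝ) < (m : ℝ) - 1 := by linarith
  have hcast : ((((m - 1) ^ k : ℕ) : ℝ)) = ((m : ℝ) - 1) ^ k := by
    rw [Nat.cast_pow, Nat.cast_sub (by omega : 1 ≤ m), Nat.cast_one]
  rw [hcast] at key
  have hmk : (((m ^ k : ℕ) : ℝ)) = (m : ℝ) ^ k := by rw [Nat.cast_pow]
  rw [hmk] at key
  have hs' : (0 : ℝ) < (s : ℝ) := by exact_mod_cast hs
  have hk' : (0 : ℝ) < (k : ℝ) := by exact_mod_cast hk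
  have hm0 : (0 : ℝ) < (m : ℝ) := by linarith
  have hpow : (((m : ℝ) - 1) ^ k) ^ (omega ℂ / 3) = ((m : ℝ) - 1) ^ ((k : ℝ) * (omega ℂ / 3)) := by
    rw [← Real.rpow_natCast, ← Real.rpow_mul hX0.le]
  rw [hpow] at key
  have hlogX : 0 < Real.log ((m : ℝ) - 1) := Real.log_pos hX1
  have hD : 0 < (k : ℝ) * Real.log ((m : ℝ) - 1) := mul_pos hk' hlogX
  -- take logarithms
  have hlhs : 0 < (s : ℝ) * ((m : ℝ) - 1) ^ ((k : ℝ) * (omega ℂ / 3)) :=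
    mul_pos hs' (Real.rpow_pos_of_pos hX0 _)
  have hlog := Real.log_le_log hlhs key
  rw [Real.log_mul hs'.ne' (Real.rpow_pos_of_pos hX0 _).ne', Real.log_rpow hX0, Real.log_pow] at hlog
  rw [le_div_iff₀ hD]
  nlinarith [hlog]

/-- **Decimal consequences are integer inequalities.** With a local strong USP of `s ≥ 1` rows and width `k ≥ 1`,
`m ≥ 3` and naturals `a`, `b ≥ 1`: if `m^{3bk} ≤ s^{3b} · (m-1)^{ak}` then `ω ≤ a / b`.
(From `s (m-1)^{kω/3} ≤ m^k`: were `ω > a/b`, then `s (m-1)^{ka/(3b)} < m^k`, and raising to the power `3b`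
contradicts the hypothesis.) [cite: CohnKleinbergSzegedyUmans2005, Thm. 33 and Thm. 31] -/
theorem omega_le_div_of_isLocalStrongUSP {s k : ℕ} {row : Fin s → Fin k → Fin 3}
    (hU : IsLocalStrongUSP row) (hs : 0 < s) (hk : 0 < k) {m : ℕ} (hm : 3 ≤ m) {a b : ℕ} (hb : 0 < b)
    (h : m ^ (3 * b * k) ≤ s ^ (3 * b) * (m - 1) ^ (a * k)) :
    omega ℂ ≤ (a : ℝ) / (b : ℝ) := by
  have hB := omega_le_of_isLocalStrongUSP hU hs hk hm
  have hX1 : (1 : ℝ) < (m : ℝ) - 1 := by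
    have : (3 : ℝ) ≤ (m : ℝ) := by exact_mod_cast hm
    linarith
  have hX0 : (0 : ℝ) < (m : ℝ) - 1 := by linarith
  have hs' : (0 : ℝ) < (s : ℝ) := by exact_mod_cast hs
  have hk' : (0 : ℝ) < (k : ℝ) := by exact_mod_cast hk
  have hb' : (0 : ℝ) < (b : ℝ) := by exact_mod_cast hb
  have hm0 : (0 : ℝ) < (m : ℝ) := by linarith
  have hlogX : 0 < Real.log ((m : ℝ) - 1) := Real.log_pos hX1
  have hD : 0 < (k : ℝ) * Real.log ((m : ℝ) - 1) := mul_pos hk' hlogX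
  -- the integer hypothesis in logarithmic form: 3bk log m ≤ 3b log s + ak log(m-1)
  have hR : ((m ^ (3 * b * k) : ℕ) : ℝ) ≤ ((s ^ (3 * b) * (m - 1) ^ (a * k) : ℕ) : ℝ) := by
    exact_mod_cast h
  rw [Nat.cast_pow, Nat.cast_mul, Nat.cast_pow, Nat.cast_pow, Nat.cast_sub (by omega : 1 ≤ m),
    Nat.cast_one] at hR
  have hpos1 : (0 : ℝ) < (m : ℝ) ^ (3 * b * k) := pow_pos hm0 _
  have hlog := Real.log_le_log hpos1 hR
  rw [Real.log_pow, Real.log_mul (pow_pos hs' _).ne' (pow_pos hX0 _).ne', Real.log_pow, Real.log_pow] at hlog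
  -- combine with the closed form
  refine hB.trans ?_
  rw [div_le_div_iff₀ hD hb']
  push_cast at hlog ⊢
  nlinarith [hlog, hlogX, hk', hb', Real.log_pos (show (1 : ℝ) < 3 by norm_num)]

end Summit.MatrixMultiplication.OmegaCensus

end
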